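import Literature.AlgebraicGeometry.Frobenioids.PadicKummerThm24iFrobenioidRelBase
import Literature.AlgebraicGeometry.Frobenioids.PadicFrobenioidThm12Proofs
import HarnessLib

/-!
# Frobenioids II, Theorem 2.4 setting: "`Π₁ ⥲ Π₂` lies over `G₁ ⥲ G₂` [cf. Theorem 1.2, (ii)]" — the input `hkerθ` DERIVED

Mochizuki, *The geometry of Frobenioids II*, Kyushu J. Math. **62** (2008) 401–460, §2, Theorem 2.4 p. 19
[cite: MochizukiFrdII2008, Thm 2.4 (i) p.19]: "`Ψ` … necessarily induces a 1-compatible equivalence of categories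
`Ψ_Base : D₁ ⥲ D₂`, hence an outer isomorphism of topological groups `Π₁ ⥲ Π₂` … that lies over an outer isomorphism of
topological groups `G₁ ⥲ G₂` [cf. Theorem 1.2, (ii)]"; Theorem 1.2 (ii) p. 9 [cite: MochizukiFrdII2008, Thm 1.2 (ii) p.9]:
"the natural action of `Aut_C(A)` on `O^⊳(A)`, `O^×(A)` factors through `Aut_{D₀}(A₀)` … this factorization determines a
faithful action of the image of `Aut_C(A)` in `Aut_{D₀}(A₀)`".

Sequel (seat abc-iut-L1-t7, gen 6) to `PadicKummerThm24iFrobenioidRelBase.lean`: there Theorem 2.4 (i) over the general §2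
bases holds modulo {hO, `θ` + `εF`, `hkerθ`, map_H, hfs}, `hkerθ : ∀ x, φ₁ x = 1 ↔ φ₂ (θ x) = 1` ("`θ` lies over
`G₁ ⥲ G₂`", `Gᵢ = Im(Πᵢ → G_{ℚ_{pᵢ}})`) being a free input.  This PROOF-ONLY file derives `hkerθ` from print's reference
"[cf. Theorem 1.2, (ii)]" — abc-iut-L1-d8's PROVED `Datum.conj_eq_conj_of_mapIso_eq` / `mapIso_eq_of_conj_eq_conj`
(`PadicFrobenioidThm12Proofs.lean`) — together with hO ("`Ψ` preserves `O^⊳`") and `εF` ("`Ψ_Base = θ_*`"):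

* §1 one Frobenioid: `resK α = 1 ↔ Base₀(α⁻¹) = id` (`resK_eq_one_iff_toBaseZero_map`) `↔ α` centralises `O^⊳(A)`
  (`toBaseZero_map_eq_id_iff_conj`, Thm. 1.2 (ii)); and for `α` lifting right translation by `g` on a Galois `A_D = Π/V`:
  `resK α = 1 ↔ g ∈ V · Ker(φ)` (`resK_eq_one_iff_exists_mem`);
* §2 along `Ψ` (fully faithful, hO): "`α` centralises `O^⊳(A)`" is preserved (`conj_trivial_iff_map`), so
  `resK₁ α = 1 ↔ resK₂ (Ψα) = 1`; and `(ΨA)_D = Π₂/θ(V)` on the nose (`sg_obj_eq_mapOpen`, from `εF`), whence for the lift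
  `α` of `r_g`: `resK₂ (Ψα) = 1 ↔ θ g ∈ θ(V) · Ker(φ₂)`;
* §3 **`hker_of_basePush`**: `Ker(φ₁) = θ⁻¹(Ker(φ₂))` — both closed, and they agree modulo every open normal
  `V ⊆ Π₁°` (a neighbourhood basis, `Π₁` tempered) by §1–§2 at the test objects `(Π₁/V, 0)`.

Consequently the residual inputs of Theorem 2.4 (i) over general bases are EXACTLY {hO ([FrdI] Cor. 4.10/4.11), `Ψ_Base`
an equivalence with `η` ([FrdI] Thm. 3.4 (v) / [FrdII] Thm. 1.2 (i)) — giving `θ`, `εF` by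
`BaseGaloisSystem.exists_hom_pushIso_of_relCosetCat_equivalence` —, map_H (printed assumption), hfs}. Classical
bookkeeping over landed files; nothing here concerns [IUTchIII]; no statement of the paper is strengthened.
-/

noncomputable section

namespace Literature.AlgebraicGeometry.Frobenioids

namespace PadicFrd

namespace RelGal

open CategoryTheory Function Literature.AnabelianGeometry.SemiGraphs QuasiTemperoid
open _root_.Topology Filter

/-! ### §1 One Frobenioid: `resK α = 1`, the base-field action, and Theorem 1.2 (ii) -/

section OneSide

variable {p : ℕ} [Fact p.Prime] {P : Type} [Group P] [TopologicalSpace P]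
  (φ₀ : P →* GalFbar ℚ_[p]) (hφ₀ : IsOpenHom φ₀) {P₀ : OpenSubgroup P}
  (d : Datum (RelCosetCat P₀) p) (hd : d.base = relBaseGal p P₀ φ₀ hφ₀) (A : d.frobenioid)

/-- `θ_*`-triviality of a base endomorphism read on a representative: `φ₀_*(h) = 1` iff `φ₀(π) ∈ φ₀(V)` for `h(1·V) = π·V`.
[cite: MochizukiFrdII2008, Def 2.2 (i) p.17] -/
theorem push_map_eq_id_iff_mem (h : A.base.obj ⟶ A.base.obj) (π : P) (hπ : (π : A.base.obj.carrier) = CosetCat.pt h) :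
    (CosetCat.push φ₀ hφ₀.isOpenMap).map h = 𝟙 _ ↔ φ₀ π ∈ CosetCat.mapOpen φ₀ hφ₀.isOpenMap A.base.obj.sg := by
  have hpt : CosetCat.pt ((CosetCat.push φ₀ hφ₀.isOpenMap).map h) =
      ((φ₀ π : GalFbar ℚ_[p]) : (objCoset φ₀ hφ₀ d A).carrier) := by
    rw [CosetCat.pt_push_map, ← hπ, CosetCat.pushQuot_coe]
  constructor
  · intro h1
    have h2 := congrArg CosetCat.pt h1
    rw [hpt, CosetCat.pt_id, QuotientGroup.eq, mul_one, inv_mem_iff] at h2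
    exact h2
  · intro h1
    apply CosetCat.hom_ext
    rw [hpt, CosetCat.pt_id, QuotientGroup.eq, mul_one, inv_mem_iff]
    exact h1

include hd in
/-- **`resK α = 1` iff `Base(α⁻¹)` acts as the identity on the base field `K_A`** (through `D → D₀`, read via
`fldEquiv`/`twist`). [cite: MochizukiFrdII2008, Thm 1.2 (ii) p.9] -/
theorem resK_eq_one_iff_toBaseZero_map (α : Aut A) :
    resK φ₀ hφ₀ d A α = 1 ↔ d.toBaseZero.map α.inv = 𝟙 _ := by
  constructor
  · intro h
    apply PadicFld.hom_ext
    refine RingHom.ext fun x => ?_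
    have h1 := resK_twist_fldEquiv φ₀ hφ₀ d hd A α x
    rw [h, AlgEquiv.one_apply] at h1
    have h2 := (fldEquiv φ₀ hφ₀ d hd A).injective ((twist φ₀ hφ₀ d A).injective h1)
    rw [PadicFld.id_alg, RingHom.id_apply]
    exact h2.symm
  · intro h
    apply AlgEquiv.ext
    intro b
    obtain ⟨x, rfl⟩ : ∃ x : d.fld A.base, twist φ₀ hφ₀ d A (fldEquiv φ₀ hφ₀ d hd A x) = b :=
      ⟨(fldEquiv φ₀ hφ₀ d hd A).symm ((twist φ₀ hφ₀ d A).symm b), by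
        rw [RingEquiv.apply_symm_apply, RingEquiv.apply_symm_apply]⟩
    rw [resK_twist_fldEquiv φ₀ hφ₀ d hd A α x, h, PadicFld.id_alg, RingHom.id_apply, AlgEquiv.one_apply]

/-- `Base₀(α⁻¹) = id` iff `Base₀(α) = Base₀(id)` as isomorphisms of `D₀`. [cite: MochizukiFrdII2008, Thm 1.2 (ii) p.9] -/
theorem toBaseZero_map_eq_id_iff_mapIso (α : Aut A) :
    d.toBaseZero.map α.inv = 𝟙 _ ↔ d.toBaseZero.mapIso α = d.toBaseZero.mapIso (Iso.refl A) := by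
  rw [CategoryTheory.Functor.mapIso_refl]
  constructor
  · intro h
    apply Iso.ext
    have h2 : d.toBaseZero.map α.hom ≫ d.toBaseZero.map α.inv = 𝟙 _ := by
      rw [← d.toBaseZero.map_comp, Iso.hom_inv_id, CategoryTheory.Functor.map_id]
    rw [h, Category.comp_id] at h2
    exact h2
  · intro h
    have h2 : d.toBaseZero.map α.inv = (d.toBaseZero.mapIso α).inv := rfl
    rw [h2, h]
    rfl

/-- **Theorem 1.2 (ii) read as a kernel statement**: `Base₀(α⁻¹) = id` in `D₀` iff `α` CENTRALISES `O^⊳(A)` (conjugation by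
`α` fixes every base-identity linear endomorphism) — abc-iut-L1-d8's two clauses at `β = id`.
[cite: MochizukiFrdII2008, Thm 1.2 (ii) p.9] -/
theorem toBaseZero_map_eq_id_iff_conj (α : Aut A) :
    d.toBaseZero.map α.inv = 𝟙 _ ↔
      ∀ f ∈ PreFrobenioid.endSubmonoid d.structureFunctor A, α.hom ≫ f ≫ α.inv = f := by
  rw [toBaseZero_map_eq_id_iff_mapIso]
  constructor
  · intro h f hf
    have h2 := d.conj_eq_conj_of_mapIso_eq A α (Iso.refl A) h f hf
    rwa [Iso.refl_hom, Iso.refl_inv, Category.id_comp, Category.comp_id] at h2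
  · intro h
    exact d.mapIso_eq_of_conj_eq_conj A α (Iso.refl A) fun f hf => by
      rw [h f hf, Iso.refl_hom, Iso.refl_inv, Category.id_comp, Category.comp_id]

/-- **For `α` lifting right translation by `g` on a Galois `A_D = Π/V`: `resK α = 1 ↔ g ∈ V · Ker(φ₀)`** (`φ₀(g) ∈ φ₀(V)`).
[cite: MochizukiFrdII2008, Def 2.2 (i) p.17] -/
theorem resK_eq_one_iff_exists_mem (α : Aut A) (g : P)
    (hg : ((g : P) : A.base.obj.carrier) = CosetCat.pt (ModelFrobenioid.baseMap α.inv).hom) :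
    resK φ₀ hφ₀ d A α = 1 ↔ ∃ v ∈ A.base.obj.sg, φ₀ (v⁻¹ * g) = 1 := by
  rw [resK_eq_one_iff, push_map_eq_id_iff_mem φ₀ hφ₀ d A _ g hg, CosetCat.mem_mapOpen]
  constructor
  · rintro ⟨v, hv, hvg⟩
    exact ⟨v, hv, by rw [map_mul, map_inv, hvg, inv_mul_cancel]⟩
  · rintro ⟨v, hv, hvg⟩
    refine ⟨v, hv, ?_⟩
    rw [map_mul, map_inv, inv_mul_eq_one] at hvg
    exact hvg

end OneSide

/-! ### §2 Along `Ψ`: centralising `O^⊳` is preserved; `(ΨA)_D = Π₂/θ(V)` -/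

section TwoSides

variable {p₁ p₂ : ℕ} [Fact p₁.Prime] [Fact p₂.Prime]
  {P₁ : Type} [Group P₁] [TopologicalSpace P₁] (φ₁ : P₁ →* GalFbar ℚ_[p₁]) (hφ₁ : IsOpenHom φ₁) {P₁₀ : OpenSubgroup P₁}
  {d₁ : Datum (RelCosetCat P₁₀) p₁} (hd₁ : d₁.base = relBaseGal p₁ P₁₀ φ₁ hφ₁)
  {P₂ : Type} [Group P₂] [TopologicalSpace P₂] (φ₂ : P₂ →* GalFbar ℚ_[p₂]) (hφ₂ : IsOpenHom φ₂) {P₂₀ : OpenSubgroup P₂}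
  {d₂ : Datum (RelCosetCat P₂₀) p₂} (hd₂ : d₂.base = relBaseGal p₂ P₂₀ φ₂ hφ₂)
  (F : d₁.frobenioid ⥤ d₂.frobenioid) [F.Full] [F.Faithful] (A : d₁.frobenioid)
  (hO : ∀ f : A ⟶ A, f ∈ PreFrobenioid.endSubmonoid d₁.structureFunctor A ↔
    F.map f ∈ PreFrobenioid.endSubmonoid d₂.structureFunctor (F.obj A))

include hO in
/-- **`Ψ` preserves "`α` centralises `O^⊳(A)`"** (`Ψ` fully faithful and `Ψ(O^⊳(A)) = O^⊳(ΨA)`).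
[cite: MochizukiFrdII2008, Thm 2.4 (i) p.19] -/
theorem conj_trivial_iff_map (α : Aut A) :
    (∀ f ∈ PreFrobenioid.endSubmonoid d₁.structureFunctor A, α.hom ≫ f ≫ α.inv = f) ↔
      ∀ g ∈ PreFrobenioid.endSubmonoid d₂.structureFunctor (F.obj A),
        (F.mapIso α).hom ≫ g ≫ (F.mapIso α).inv = g := by
  constructor
  · intro h g hg
    obtain ⟨f, rfl⟩ := F.map_surjective g
    rw [CategoryTheory.Functor.mapIso_hom, CategoryTheory.Functor.mapIso_inv, ← F.map_comp, ← F.map_comp,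
      h f ((hO f).mpr hg)]
  · intro h f hf
    apply F.map_injective
    rw [F.map_comp, F.map_comp]
    exact h (F.map f) ((hO f).mp hf)

include hd₁ hd₂ hO in
/-- **`resK₁ α = 1 ↔ resK₂ (Ψα) = 1`** (Theorem 1.2 (ii) on both sides + `conj_trivial_iff_map`).
[cite: MochizukiFrdII2008, Thm 2.4 (i) p.19] -/
theorem resK_eq_one_iff_resK_map_eq_one (α : Aut A) :
    resK φ₁ hφ₁ d₁ A α = 1 ↔ resK φ₂ hφ₂ d₂ (F.obj A) (F.mapIso α) = 1 := by
  rw [resK_eq_one_iff_toBaseZero_map φ₁ hφ₁ d₁ hd₁ A α, toBaseZero_map_eq_id_iff_conj,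
    resK_eq_one_iff_toBaseZero_map φ₂ hφ₂ d₂ hd₂ (F.obj A) (F.mapIso α), toBaseZero_map_eq_id_iff_conj]
  exact conj_trivial_iff_map F A hO α

variable (θ : P₁ →* P₂) (hθo : IsOpenMap θ) (hθs : Surjective θ)
  (e : (CosetCat.push θ hθo).obj A.base.obj ≅ (F.obj A).base.obj)

omit [F.Full] [F.Faithful] in
include hθs e in
/-- **`(ΨA)_D = Π₂/θ(V)` on the nose** for `A_D = Π/V` Galois: an isomorphism `θ_*(Π₁/V) ≅ (ΨA)_D` in `B^temp(Π₂)⁰` forces the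
open subgroup of `(ΨA)_D` to be a conjugate of the NORMAL subgroup `θ(V)`. [cite: MochizukiFrdII2008, Thm 2.4 (i) p.19] -/
theorem sg_obj_eq_mapOpen (hA : A.base.obj.sg.toSubgroup.Normal) :
    (F.obj A).base.obj.sg = CosetCat.mapOpen θ hθo A.base.obj.sg := by
  have hN : (CosetCat.mapOpen θ hθo A.base.obj.sg).toSubgroup.Normal := hA.map θ hθs
  obtain ⟨c, hc⟩ := QuotientGroup.mk_surjective (CosetCat.pt e.hom)
  obtain ⟨c', hc'⟩ := QuotientGroup.mk_surjective (CosetCat.pt e.inv)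
  ext w
  constructor
  · intro hw
    have h1 := CosetCat.conj_mem_of_mem e.inv c' hc' hw
    have h2 := hN.conj_mem _ h1 c'
    rwa [show c' * (c'⁻¹ * w * c') * c'⁻¹ = w by group] at h2
  · intro hw
    have h1 := hN.conj_mem _ hw c
    have h2 := CosetCat.conj_mem_of_mem e.hom c hc h1
    rwa [show c⁻¹ * (c * w * c⁻¹) * c = w by group] at h2

variable (compat : ∀ α : Aut A, (ModelFrobenioid.baseMap (F.mapIso α).inv).hom =
    e.inv ≫ (CosetCat.push θ hθo).map (ModelFrobenioid.baseMap α.inv).hom ≫ e.hom)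

omit [F.Full] [F.Faithful] in
include hθs compat in
/-- **For the lift `α` of `r_g` on a Galois `A_D = Π₁/V`: `resK₂ (Ψα) = 1 ↔ θ g ∈ θ(V) · Ker(φ₂)`.**  (`Base((Ψα)⁻¹)(1) =
c'·θ(g)·c` with `c'c ∈ θ(V)`, `θ(V) ⊴ Π₂`.) [cite: MochizukiFrdII2008, Thm 2.4 (i) p.19] -/
theorem resK_map_eq_one_iff_exists_mem (hA : A.base.obj.sg.toSubgroup.Normal) (α : Aut A) (g : P₁)
    (hg : ((g : P₁) : A.base.obj.carrier) = CosetCat.pt (ModelFrobenioid.baseMap α.inv).hom) :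
    resK φ₂ hφ₂ d₂ (F.obj A) (F.mapIso α) = 1 ↔ ∃ v ∈ A.base.obj.sg, φ₂ (θ (v⁻¹ * g)) = 1 := by
  have hN : (CosetCat.mapOpen θ hθo A.base.obj.sg).toSubgroup.Normal := hA.map θ hθs
  have hsg := sg_obj_eq_mapOpen F A θ hθo hθs e hA
  obtain ⟨c, hc⟩ := QuotientGroup.mk_surjective (CosetCat.pt e.hom)
  obtain ⟨c', hc'⟩ := QuotientGroup.mk_surjective (CosetCat.pt e.inv)
  -- the representative of `Base((Ψα)⁻¹)(1·V₂)`
  have hθg : ((θ g : P₂) : ((CosetCat.push θ hθo).obj A.base.obj).carrier) =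
      CosetCat.pt ((CosetCat.push θ hθo).map (ModelFrobenioid.baseMap α.inv).hom) := by
    rw [CosetCat.pt_push_map, ← hg, CosetCat.pushQuot_coe]
  have hrep : ((c' * (θ g * c) : P₂) : (F.obj A).base.obj.carrier) =
      CosetCat.pt (ModelFrobenioid.baseMap (F.mapIso α).inv).hom := by
    rw [compat α]
    exact CosetCat.coe_eq_pt_conj e _ c c' (θ g) hc hc' hθg
  have hcc : c' * c ∈ (F.obj A).base.obj.sg := CosetCat.rep_inv_mul_rep_mem e c c' hc hc'
  rw [resK_eq_one_iff_exists_mem φ₂ hφ₂ d₂ (F.obj A) (F.mapIso α) (c' * (θ g * c)) hrep, hsg]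
  rw [hsg] at hcc
  constructor
  · rintro ⟨w, hw, hwg⟩
    -- `w⁻¹ c' θg c ∈ Ker φ₂` with `w ∈ θ(V)`; conjugate back by `c`
    obtain ⟨u, hu, hθu⟩ := (CosetCat.mem_mapOpen θ hθo).mp
      (show c * ((c' * c)⁻¹ * w) * c⁻¹ ∈ CosetCat.mapOpen θ hθo A.base.obj.sg from
        hN.conj_mem _ (mul_mem (inv_mem hcc) hw) c)
    refine ⟨u, hu, ?_⟩
    have key : θ (u⁻¹ * g) = c * ((w⁻¹ * (c' * (θ g * c))) * c⁻¹) := by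
      rw [map_mul, map_inv, hθu]
      group
    rw [key, map_mul, map_mul, hwg, one_mul, ← map_mul, mul_inv_cancel, map_one]
  · rintro ⟨v, hv, hvg⟩
    refine ⟨(c' * c) * (c⁻¹ * θ v * c), mul_mem hcc (by
      have := hN.conj_mem _ ((CosetCat.mem_mapOpen θ hθo).mpr ⟨v, hv, rfl⟩) c⁻¹
      rwa [inv_inv] at this), ?_⟩
    have key : ((c' * c) * (c⁻¹ * θ v * c))⁻¹ * (c' * (θ g * c)) = c⁻¹ * θ (v⁻¹ * g) * c := by
      rw [map_mul, map_inv]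
      group
    rw [key, map_mul, map_mul, hvg, mul_one, ← map_mul, inv_mul_cancel, map_one]

end TwoSides

/-! ### §3 `Ker(φ₁) = θ⁻¹(Ker(φ₂))` -/

section Kernel

variable {p₁ p₂ : ℕ} [Fact p₁.Prime] [Fact p₂.Prime]
  {P₁ : Type} [Group P₁] [TopologicalSpace P₁] [IsTopologicalGroup P₁] (hP₁ : IsTempered P₁)
  (φ₁ : P₁ →* GalFbar ℚ_[p₁]) (hφ₁ : IsOpenHom φ₁) {P₁₀ : OpenSubgroup P₁}
  {d₁ : Datum (RelCosetCat P₁₀) p₁} (hd₁ : d₁.base = relBaseGal p₁ P₁₀ φ₁ hφ₁)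
  {P₂ : Type} [Group P₂] [TopologicalSpace P₂] (φ₂ : P₂ →* GalFbar ℚ_[p₂]) (hφ₂ : IsOpenHom φ₂) {P₂₀ : OpenSubgroup P₂}
  {d₂ : Datum (RelCosetCat P₂₀) p₂} (hd₂ : d₂.base = relBaseGal p₂ P₂₀ φ₂ hφ₂)
  (F : d₁.frobenioid ⥤ d₂.frobenioid) [F.Full] [F.Faithful]
  (hO : ∀ (A : d₁.frobenioid) (f : A ⟶ A), f ∈ PreFrobenioid.endSubmonoid d₁.structureFunctor A ↔
    F.map f ∈ PreFrobenioid.endSubmonoid d₂.structureFunctor (F.obj A))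
  (θ : P₁ →* P₂) (hθc : Continuous θ) (hθo : IsOpenMap θ) (hθs : Surjective θ)
  (εF : F ⋙ ModelFrobenioid.baseFunctor d₂.Φ d₂.B d₂.divB ⋙ RelCosetCat.incl P₂₀ ≅
    ModelFrobenioid.baseFunctor d₁.Φ d₁.B d₁.divB ⋙ RelCosetCat.incl P₁₀ ⋙ CosetCat.push θ hθo)

/-- A closed set containing, for every member `V` of a neighbourhood basis of `1` consisting of subsets, some `v⁻¹ g`
(`v ∈ V`) contains `g`. [folklore] -/
private theorem mem_of_forall_exists_inv_mul_mem {S : Set P₁} (hS : IsClosed S) (g : P₁)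
    (h : ∀ U ∈ 𝓝 (1 : P₁), ∃ v ∈ U, v⁻¹ * g ∈ S) : g ∈ S := by
  by_contra hg
  have hcont : Continuous fun v : P₁ => v⁻¹ * g := continuous_inv.mul continuous_const
  have h1 : (fun v : P₁ => v⁻¹ * g) 1 ∈ Sᶜ := by
    show (1 : P₁)⁻¹ * g ∈ Sᶜ
    rwa [inv_one, one_mul]
  have hW : (fun v : P₁ => v⁻¹ * g) ⁻¹' Sᶜ ∈ 𝓝 (1 : P₁) :=
    hcont.continuousAt.preimage_mem_nhds (hS.isOpen_compl.mem_nhds h1)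
  obtain ⟨v, hv, hvS⟩ := h _ hW
  exact hv hvS

omit [IsTopologicalGroup P₁] in
include hP₁ in
/-- For `Π₁` tempered, the open normal subgroups `V ⊆ Π₁°` are a neighbourhood basis of `1`. [cite: MochizukiSemiAnbd2006, Def 3.1(i) p.33] -/
theorem exists_openNormal_le (U : Set P₁) (hU : U ∈ 𝓝 (1 : P₁)) :
    ∃ V : OpenNormalSubgroup P₁, V.toOpenSubgroup ≤ P₁₀ ∧ (V : Set P₁) ⊆ U := by
  obtain ⟨V, -, hV⟩ := hP₁.basis (U ∩ (P₁₀ : Set P₁)) (Filter.inter_mem hU P₁₀.mem_nhds_one)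
  exact ⟨V, fun x hx => (hV hx).2, fun x hx => (hV hx).1⟩

include hP₁ hd₁ hd₂ hO hθc hθs εF in
/-- **"`Π₁ ⥲ Π₂` lies over `G₁ ⥲ G₂` [cf. Theorem 1.2, (ii)]" — `hkerθ` DERIVED**: for `Ψ : C₁ ⥤ C₂` fully faithful
preserving `O^⊳` (hO) whose action on bases is `θ_*` 1-compatibly (`εF`, `θ` continuous open surjective), `Ker(Π₁ → G_{ℚ_{p₁}})
= θ⁻¹(Ker(Π₂ → G_{ℚ_{p₂}}))`.  At each test object `(Π₁/V, 0)` (`V ⊴ Π₁` open, `V ⊆ Π₁°`) the lift `α` of `r_g` has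
`resK₁ α = 1 ↔ g ∈ V·Ker φ₁` and `resK₂ (Ψα) = 1 ↔ θ g ∈ θ(V)·Ker φ₂`, the two being equivalent by Theorem 1.2 (ii); both
kernels are closed and the `V` form a neighbourhood basis. [cite: MochizukiFrdII2008, Thm 2.4 (i) p.19] -/
theorem hker_of_basePush (x : P₁) : φ₁ x = 1 ↔ φ₂ (θ x) = 1 := by
  haveI : T2Space (GalFbar ℚ_[p₁]) := krullTopology_t2
  haveI : T2Space (GalFbar ℚ_[p₂]) := krullTopology_t2
  -- at a test object over `Π₁/V`: `g ∈ V·Ker φ₁ ↔ θ g ∈ θ(V)·Ker φ₂`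
  have step : ∀ (V : OpenNormalSubgroup P₁) (hV : V.toOpenSubgroup ≤ P₁₀) (g : P₁),
      (∃ v ∈ V, φ₁ (v⁻¹ * g) = 1) ↔ ∃ v ∈ V, φ₂ (θ (v⁻¹ * g)) = 1 := by
    intro V hV g
    let A : d₁.frobenioid := ⟨⟨⟨V.toOpenSubgroup⟩, CosetCat.admitsHomTo_of_le P₁₀ hV⟩, 1⟩
    have hA : A.base.obj.sg.toSubgroup.Normal := V.isNormal'
    obtain ⟨α, hα⟩ := d₁.thm12_isAutAmple A (baseAutOfNormal d₁ A hA g)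
    have hg : ((g : P₁) : A.base.obj.carrier) = CosetCat.pt (ModelFrobenioid.baseMap α.inv).hom := by
      rw [show ModelFrobenioid.baseMap α.inv = (baseAutOfNormal d₁ A hA g).inv from congrArg Iso.inv hα,
        pt_baseAutOfNormal_inv]
    have h1 := resK_eq_one_iff_exists_mem φ₁ hφ₁ d₁ A α g hg
    have h2 := resK_map_eq_one_iff_exists_mem φ₂ hφ₂ F A θ hθo hθs (baseIsoOfPush F θ hθo εF A)
      (compat_ofPush F θ hθo εF A) hA α g hg
    have h12 := resK_eq_one_iff_resK_map_eq_one φ₁ hφ₁ hd₁ φ₂ hφ₂ hd₂ F A (hO A) α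
    exact (h1.symm.trans h12).trans h2
  -- closedness of the two kernels
  have hK₁ : IsClosed {y : P₁ | φ₁ y = 1} := isClosed_singleton.preimage hφ₁.continuous
  have hK₂ : IsClosed {y : P₁ | φ₂ (θ y) = 1} := isClosed_singleton.preimage (hφ₂.continuous.comp hθc)
  constructor
  · intro hx
    refine mem_of_forall_exists_inv_mul_mem hK₂ x fun U hU => ?_
    obtain ⟨V, hV, hVU⟩ := exists_openNormal_le hP₁ U hU
    obtain ⟨v, hv, hvx⟩ := (step V hV x).mp ⟨1, one_mem _, by rwa [inv_one, one_mul]⟩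
    exact ⟨v, hVU hv, hvx⟩
  · intro hx
    refine mem_of_forall_exists_inv_mul_mem hK₁ x fun U hU => ?_
    obtain ⟨V, hV, hVU⟩ := exists_openNormal_le hP₁ U hU
    obtain ⟨v, hv, hvx⟩ := (step V hV x).mpr ⟨1, one_mem _, by rwa [inv_one, one_mul]⟩
    exact ⟨v, hVU hv, hvx⟩

end Kernel

end RelGal

end PadicFrd

end Literature.AlgebraicGeometry.Frobenioids

end
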